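import Mathlib.Data.Real.Basic
import Mathlib.Tactic.Linarith
import Mathlib.Tactic.Positivity
import Mathlib.Tactic.FieldSimp
import HarnessLib
import HarnessLib.Audit

/-!
# `NoHeavyLowerTail` (crux stmt-CriticalPhenomena-4575), Sahi programme P4 (Holley / monotone coupling):
# the maj-slot certificate on the pattern `2³` — III: regime B1 (top only) — the two halves with explicit retained masses

Support file (cell `prim-l12`, seat P4, generation 9; `--supports stmt-CriticalPhenomena-4575`).  No named facts, no
sorries; standard axioms; pure real algebra.  The proofs are machine-found certificates: every item is closed by `linarith` from an
explicit nonnegative combination of the listed facts (an exact rational Positivstellensatz-type certificate found by linear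
programming over products of the facts with nonnegative aggregate masses, verified in exact arithmetic before emission; generator
and certificates in HOME prim-l12-p4/code/gen9, memo FROM-prim-l12-p4-gen9-MAJ-SLOT-LEAN.md).

Setting (memo HOME prim-l12-p4/FROM-prim-l12-p4-gen8-PATTERN-CERTIFICATES.md §4b): the pattern `2³` of three join-primes with the
majority slot `MAJ = {ij, ik, jk, ⊤}`; for a labelling `(i, j, k)` of the atoms the eight fibre masses are `nE, ni, nj, nk, nij,
nik, njk, nT` with total `Z` (kept as a symbol; `d = nE+ni+nj+nk`, `u = nij+nik+njk+nT`, NOT normalised); the hypotheses are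
consequences of log-supermodularity of the pattern measure (`…SahiE3MajPatternFacts.facts_of_pattern`); the conclusions are the
validity / up-transport / pair inequalities for retained masses `rij, rik, rjk, rT` (homogeneous of degree three) consumed by
`…SahiE3MajPattern.certificate_of_ineqs`.  Regimes: A (top full, uniform rank-2 fill), A'(k) (top full, Hall(k) tight), B1 (top
only), B2(k) (donors of k drained) — HOME memo §4b; the case analysis is `…SahiE3MajCore.exists_cert`.
-/

namespace Summit.CriticalPhenomena.PercolationContinuityZ3.Theorems.SahiE3MajCert

/-- **Regime B1** (top only: `r = (0, 0, 0, Z²u)`), valid when `Z·N₂ ≤ d·n_⊤` and `u(Z + n_x) ≤ (Z+d)·B_x` for the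
        three atoms. [this work] Part 1: validity and up-transport, with the explicit retained masses. -/
theorem cert_B1_valid (nE ni nj nk nij nik njk nT Z : ℝ)
    (h_nn_E : 0 ≤ nE) (h_nn_0 : 0 ≤ ni) (h_nn_1 : 0 ≤ nj) (h_nn_2 : 0 ≤ nk) (h_nn_01 : 0 ≤ nij) (h_nn_02 : 0 ≤ nik)
    (h_nn_12 : 0 ≤ njk) (h_nn_T : 0 ≤ nT) (h_nn_Z : 0 ≤ Z) (hN2 : Z * (nij + nik + njk) ≤ (nE + ni + nj + nk) * nT)
    (hB_i : (nij + nik + njk + nT) * (Z + ni) ≤ (Z + (nE + ni + nj + nk)) * (nij + nik + nT))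
    (hB_j : (nij + nik + njk + nT) * (Z + nj) ≤ (Z + (nE + ni + nj + nk)) * (nij + njk + nT))
    (hB_k : (nij + nik + njk + nT) * (Z + nk) ≤ (Z + (nE + ni + nj + nk)) * (nik + njk + nT)) :
    0 ≤ (0 : ℝ) ∧
    0 ≤ (0 : ℝ) ∧
    0 ≤ (0 : ℝ) ∧
    0 ≤ (Z*Z*(nij + nik + njk + nT)) ∧
    (0 : ℝ) ≤ Z *
            (Z + (nE + ni + nj + nk)) * nij ∧
    (0 : ℝ) ≤ Z * (Z + (nE + ni + nj + nk)) * nik ∧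
    (0 : ℝ) ≤ Z *
            (Z + (nE + ni + nj + nk)) * njk ∧
    (Z*Z*(nij + nik + njk + nT)) ≤ Z * (Z + (nE + ni + nj + nk)) * nT
            ∧
    Z * (nij + nik + njk + nT) * ni ≤ (Z * (Z + (nE + ni + nj + nk)) * nij - (0 : ℝ)) +
            (Z * (Z + (nE + ni + nj + nk)) * nik - (0 : ℝ)) +
            (Z * (Z + (nE + ni + nj + nk)) * nT - (Z*Z*(nij + nik + njk + nT))) ∧
    Z * (nij + nik + njk + nT) *
            nj ≤ (Z * (Z + (nE + ni + nj + nk)) * nij - (0 : ℝ)) + (Z * (Z + (nE + ni + nj + nk)) * njk - (0 : ℝ))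
            + (Z * (Z + (nE + ni + nj + nk)) * nT - (Z*Z*(nij + nik + njk + nT))) ∧
    Z * (nij + nik + njk + nT)
            * nk ≤ (Z * (Z + (nE + ni + nj + nk)) * nik - (0 : ℝ)) +
            (Z * (Z + (nE + ni + nj + nk)) * njk - (0 : ℝ)) +
            (Z * (Z + (nE + ni + nj + nk)) * nT - (Z*Z*(nij + nik + njk + nT))) ∧
    (0 : ℝ) + (0 : ℝ) + (0 : ℝ) +
            (Z*Z*(nij + nik + njk + nT)) = Z * Z * (nij + nik + njk + nT) ∧
    Z * Z * nT ≤
            (Z*Z*(nij + nik + njk + nT)) ∧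
    Z * Z * (nij + nT) ≤ (0 : ℝ) + (Z*Z*(nij + nik + njk + nT)) ∧
    Z
            * Z * (nik + nT) ≤ (0 : ℝ) + (Z*Z*(nij + nik + njk + nT)) ∧
    Z * Z * (njk + nT) ≤ (0 : ℝ) +
            (Z*Z*(nij + nik + njk + nT)) ∧
    Z * Z * (nij + nik + nT) ≤ (0 : ℝ) + (0 : ℝ) +
            (Z*Z*(nij + nik + njk + nT)) ∧
    Z * Z * (nij + njk + nT) ≤ (0 : ℝ) + (0 : ℝ) +
            (Z*Z*(nij + nik + njk + nT)) ∧
    Z * Z * (nik + njk + nT) ≤ (0 : ℝ) + (0 : ℝ) +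
            (Z*Z*(nij + nik + njk + nT)) := by
  refine ⟨?_, ?_, ?_, ?_, ?_, ?_, ?_, ?_, ?_, ?_, ?_, ?_, ?_, ?_, ?_, ?_, ?_, ?_, ?_⟩
  · -- r_nonneg_01
    linarith only []
  · -- r_nonneg_02
    linarith only []
  · -- r_nonneg_12
    linarith only []
  · -- r_nonneg_T
    linarith only [(by positivity : (0:ℝ) ≤ (1 : ℝ) * Z * Z * (nij + nik + njk + nT))]
  · -- cap_01
    linarith only [(by positivity : (0:ℝ) ≤ (1 : ℝ) * nij * Z * (Z + nE + ni + nj + nk))]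
  · -- cap_02
    linarith only [(by positivity : (0:ℝ) ≤ (1 : ℝ) * nik * Z * (Z + nE + ni + nj + nk))]
  · -- cap_12
    linarith only [(by positivity : (0:ℝ) ≤ (1 : ℝ) * njk * Z * (Z + nE + ni + nj + nk))]
  · -- cap_T
    linarith only [mul_nonneg (by positivity : (0:ℝ) ≤ (1 : ℝ) * Z) (sub_nonneg.2 hN2)]
  · -- hall_0
    linarith only [mul_nonneg (by positivity : (0:ℝ) ≤ (1 : ℝ) * Z) (sub_nonneg.2 hB_i)]
  · -- hall_1
    linarith only [mul_nonneg (by positivity : (0:ℝ) ≤ (1 : ℝ) * Z) (sub_nonneg.2 hB_j)]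
  · -- hall_2
    linarith only [mul_nonneg (by positivity : (0:ℝ) ≤ (1 : ℝ) * Z) (sub_nonneg.2 hB_k)]
  · -- total
    linarith only []
  · -- ut_T
    linarith only [(by positivity : (0:ℝ) ≤ (1 : ℝ) * Z * Z * (nij + nik + njk))]
  · -- ut_01
    linarith only [(by positivity : (0:ℝ) ≤ (1 : ℝ) * Z * Z * (nik + njk))]
  · -- ut_02
    linarith only [(by positivity : (0:ℝ) ≤ (1 : ℝ) * Z * Z * (nij + njk))]
  · -- ut_12
    linarith only [(by positivity : (0:ℝ) ≤ (1 : ℝ) * Z * Z * (nij + nik))]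
  · -- ut_R0
    linarith only [(by positivity : (0:ℝ) ≤ (1 : ℝ) * njk * Z * Z)]
  · -- ut_R1
    linarith only [(by positivity : (0:ℝ) ≤ (1 : ℝ) * nik * Z * Z)]
  · -- ut_R2
    linarith only [(by positivity : (0:ℝ) ≤ (1 : ℝ) * nij * Z * Z)]

/-- **Regime B1** (top only: `r = (0, 0, 0, Z²u)`), valid when `Z·N₂ ≤ d·n_⊤` and `u(Z + n_x) ≤ (Z+d)·B_x` for the
        three atoms. [this work] Part 2: the core pair inequalities with traces `{⊤}`
        (`↑(xy)` vs `↑(xz)`, `↑(xy)` vs `↑z`), explicit retained masses. -/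
theorem cert_B1_pairs (nE ni nj nk nij nik njk nT Z : ℝ)
    (h_nn_E : 0 ≤ nE) (h_nn_0 : 0 ≤ ni) (h_nn_1 : 0 ≤ nj) (h_nn_2 : 0 ≤ nk) (h_nn_01 : 0 ≤ nij) (h_nn_02 : 0 ≤ nik)
    (h_nn_12 : 0 ≤ njk) (h_nn_T : 0 ≤ nT) (h_nn_Z : 0 ≤ Z) (h_sum : Z = nE + ni + nj + nk + nij + nik + njk + nT) :
    Z * ((nij + nT) * (nik + nT) + (nik + nT) * (nij + nT)) - (nij + nik + njk + nT) * (nij + nT) * (nik + nT) ≤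
            (Z*Z*(nij + nik + njk + nT)) ∧
    Z * ((nij + nT) * (njk + nT) + (njk + nT) * (nij + nT)) -
            (nij + nik + njk + nT) * (nij + nT) * (njk + nT) ≤ (Z*Z*(nij + nik + njk + nT)) ∧
    Z *
            ((nik + nT) * (njk + nT) + (njk + nT) * (nik + nT)) - (nij + nik + njk + nT) * (nik + nT) * (njk + nT)
            ≤ (Z*Z*(nij + nik + njk + nT)) ∧
    Z * ((nij + nT) * (nik + njk + nT) + (nk + nik + njk + nT) *
            (nij + nT)) - (nij + nik + njk + nT) * (nij + nT) * (nk + nik + njk + nT) ≤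
            (Z*Z*(nij + nik + njk + nT)) ∧
    Z * ((nik + nT) * (nij + njk + nT) + (nj + nij + njk + nT) *
            (nik + nT)) - (nij + nik + njk + nT) * (nik + nT) * (nj + nij + njk + nT) ≤
            (Z*Z*(nij + nik + njk + nT)) ∧
    Z * ((njk + nT) * (nij + nik + nT) + (ni + nij + nik + nT) *
            (njk + nT)) - (nij + nik + njk + nT) * (njk + nT) * (ni + nij + nik + nT) ≤
            (Z*Z*(nij + nik + njk + nT)) := by
  refine ⟨?_, ?_, ?_, ?_, ?_, ?_⟩
  · -- pair_P01_P02
    linarith only [congrArg (fun z : ℝ => ((1 : ℝ) * nE * nT + ((1 : ℝ) / 3) * nE * nij + ((1 : ℝ) / 3) * nE * nik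
            + (1 : ℝ) * nT * Z + (-1 : ℝ) * nT * nT + (1 : ℝ) * ni * nT + ((1 : ℝ) / 3) * ni * nij + ((1 : ℝ) / 3)
            * ni * nik + ((2 : ℝ) / 3) * nij * Z + ((-5 : ℝ) / 6) * nij * nT + ((1 : ℝ) / 6) * nij * nij +
            ((-2 : ℝ) / 3) * nij * nik + ((1 : ℝ) / 6) * nij * njk + ((2 : ℝ) / 3) * nik * Z + ((-5 : ℝ) / 6) * nik
            * nT + ((1 : ℝ) / 6) * nik * nik + ((1 : ℝ) / 6) * nik * njk + (1 : ℝ) * nj * nT + ((1 : ℝ) / 3) * nj *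
            nij + ((1 : ℝ) / 3) * nj * nik + ((1 : ℝ) / 3) * njk * Z + (1 : ℝ) * nk * nT + ((1 : ℝ) / 3) * nk * nij
            + ((1 : ℝ) / 3) * nk * nik) * z) h_sum, (by positivity : (0:ℝ) ≤ ((1 : ℝ) / 3) * Z * (nij + nik + njk)
            * (Z + nE + ni + nj + nk) + ((1 : ℝ) / 3) * (nE + ni + nj + nk) * (nE + ni + nj + nk) *
            (nij + nik + nT) + ((2 : ℝ) / 3) * nT * (nE + ni + nj + nk) * (nE + ni + nj + nk) + ((1 : ℝ) / 3) * njk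
            * Z * Z + ((1 : ℝ) / 3) * njk * Z * (nij + nik + njk + nT) + ((1 : ℝ) / 2) * (nij + njk) * (nij + nT) *
            (Z + nE + ni + nj + nk) + ((1 : ℝ) / 2) * (nik + njk) * (nik + nT) * (Z + nE + ni + nj + nk) +
            ((1 : ℝ) / 6) * (nij + nik + njk + nT) * (nij + nik + njk + nT) * (nij + nik))]
  · -- pair_P01_P12
    linarith only [congrArg (fun z : ℝ => ((1 : ℝ) * nE * nT + ((1 : ℝ) / 3) * nE * nij + ((1 : ℝ) / 3) * nE * njk
            + (1 : ℝ) * nT * Z + (-1 : ℝ) * nT * nT + (1 : ℝ) * ni * nT + ((1 : ℝ) / 3) * ni * nij + ((1 : ℝ) / 3)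
            * ni * njk + ((2 : ℝ) / 3) * nij * Z + ((-5 : ℝ) / 6) * nij * nT + ((1 : ℝ) / 6) * nij * nij +
            ((1 : ℝ) / 6) * nij * nik + ((-2 : ℝ) / 3) * nij * njk + ((1 : ℝ) / 3) * nik * Z + ((1 : ℝ) / 6) * nik
            * njk + (1 : ℝ) * nj * nT + ((1 : ℝ) / 3) * nj * nij + ((1 : ℝ) / 3) * nj * njk + ((2 : ℝ) / 3) * njk *
            Z + ((-5 : ℝ) / 6) * njk * nT + ((1 : ℝ) / 6) * njk * njk + (1 : ℝ) * nk * nT + ((1 : ℝ) / 3) * nk *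
            nij + ((1 : ℝ) / 3) * nk * njk) * z) h_sum, (by positivity : (0:ℝ) ≤ ((1 : ℝ) / 3) * Z *
            (nij + nik + njk) * (Z + nE + ni + nj + nk) + ((1 : ℝ) / 3) * (nE + ni + nj + nk) * (nE + ni + nj + nk)
            * (nij + njk + nT) + ((2 : ℝ) / 3) * nT * (nE + ni + nj + nk) * (nE + ni + nj + nk) + ((1 : ℝ) / 3) *
            nik * Z * Z + ((1 : ℝ) / 3) * nik * Z * (nij + nik + njk + nT) + ((1 : ℝ) / 2) * (nij + nik) *
            (nij + nT) * (Z + nE + ni + nj + nk) + ((1 : ℝ) / 2) * (nik + njk) * (njk + nT) *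
            (Z + nE + ni + nj + nk) + ((1 : ℝ) / 6) * (nij + nik + njk + nT) * (nij + nik + njk + nT) *
            (nij + njk))]
  · -- pair_P02_P12
    linarith only [congrArg (fun z : ℝ => ((1 : ℝ) * nE * nT + ((1 : ℝ) / 3) * nE * nik + ((1 : ℝ) / 3) * nE * njk
            + (1 : ℝ) * nT * Z + (-1 : ℝ) * nT * nT + (1 : ℝ) * ni * nT + ((1 : ℝ) / 3) * ni * nik + ((1 : ℝ) / 3)
            * ni * njk + ((1 : ℝ) / 3) * nij * Z + ((1 : ℝ) / 6) * nij * nik + ((1 : ℝ) / 6) * nij * njk +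
            ((2 : ℝ) / 3) * nik * Z + ((-5 : ℝ) / 6) * nik * nT + ((1 : ℝ) / 6) * nik * nik + ((-2 : ℝ) / 3) * nik
            * njk + (1 : ℝ) * nj * nT + ((1 : ℝ) / 3) * nj * nik + ((1 : ℝ) / 3) * nj * njk + ((2 : ℝ) / 3) * njk *
            Z + ((-5 : ℝ) / 6) * njk * nT + ((1 : ℝ) / 6) * njk * njk + (1 : ℝ) * nk * nT + ((1 : ℝ) / 3) * nk *
            nik + ((1 : ℝ) / 3) * nk * njk) * z) h_sum, (by positivity : (0:ℝ) ≤ ((1 : ℝ) / 3) * Z *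
            (nij + nik + njk) * (Z + nE + ni + nj + nk) + ((1 : ℝ) / 3) * (nE + ni + nj + nk) * (nE + ni + nj + nk)
            * (nik + njk + nT) + ((2 : ℝ) / 3) * nT * (nE + ni + nj + nk) * (nE + ni + nj + nk) + ((1 : ℝ) / 3) *
            nij * Z * Z + ((1 : ℝ) / 3) * nij * Z * (nij + nik + njk + nT) + ((1 : ℝ) / 2) * (nij + nik) *
            (nik + nT) * (Z + nE + ni + nj + nk) + ((1 : ℝ) / 2) * (nij + njk) * (njk + nT) *
            (Z + nE + ni + nj + nk) + ((1 : ℝ) / 6) * (nij + nik + njk + nT) * (nij + nik + njk + nT) *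
            (nik + njk))]
  · -- pair_P01_R2
    linarith only [congrArg (fun z : ℝ => ((1 : ℝ) * nE * nT + ((1 : ℝ) / 2) * nE * nij + (1 : ℝ) * nT * Z +
            (-1 : ℝ) * nT * nT + (1 : ℝ) * ni * nT + ((1 : ℝ) / 2) * ni * nij + (1 : ℝ) * nij * Z + ((-1 : ℝ) / 4)
            * nij * nT + ((1 : ℝ) / 4) * nij * nij + ((-1 : ℝ) / 2) * nij * nik + ((-1 : ℝ) / 2) * nij * njk +
            ((1 : ℝ) / 2) * nik * Z + (-1 : ℝ) * nik * nT + (1 : ℝ) * nj * nT + ((1 : ℝ) / 2) * nj * nij +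
            ((1 : ℝ) / 2) * njk * Z + (-1 : ℝ) * njk * nT) * z) h_sum,
            (by positivity : (0:ℝ) ≤ ((1 : ℝ) / 2) * Z * (nik + njk + nT) * (nik + njk) + ((1 : ℝ) / 2) * Z *
            (nik + njk) * (Z + nE + ni + nj + nk) + (1 : ℝ) * nT * (nE + ni + nj + nk) * (nE + ni + nj + nij) +
            ((1 : ℝ) / 4) * nij * (nij + nT) * (Z + nE + ni + nj + nk) + ((1 : ℝ) / 2) * nij * (nE + ni + nj + nij)
            * (Z + nE + ni + nj + nk) + ((1 : ℝ) / 4) * nij * (nij + nik + njk + nT) * (nij + nT) + ((1 : ℝ) / 2) *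
            nij * (nij + nik + njk + nT) * (nk + nik + njk + nT))]
  · -- pair_P02_R1
    linarith only [congrArg (fun z : ℝ => ((1 : ℝ) * nE * nT + ((1 : ℝ) / 2) * nE * nik + (1 : ℝ) * nT * Z +
            (-1 : ℝ) * nT * nT + (1 : ℝ) * ni * nT + ((1 : ℝ) / 2) * ni * nik + ((1 : ℝ) / 2) * nij * Z + (-1 : ℝ)
            * nij * nT + ((-1 : ℝ) / 2) * nij * nik + (1 : ℝ) * nik * Z + ((-1 : ℝ) / 4) * nik * nT + ((1 : ℝ) / 4)
            * nik * nik + ((-1 : ℝ) / 2) * nik * njk + ((1 : ℝ) / 2) * njk * Z + (-1 : ℝ) * njk * nT + (1 : ℝ) * nk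
            * nT + ((1 : ℝ) / 2) * nk * nik) * z) h_sum, (by positivity : (0:ℝ) ≤ ((1 : ℝ) / 2) * Z *
            (nij + njk + nT) * (nij + njk) + ((1 : ℝ) / 2) * Z * (nij + njk) * (Z + nE + ni + nj + nk) +
            ((1 : ℝ) / 2) * (nE + ni + nj + nk) * (nik + nT) * (nE + ni + nk + nik) + ((1 : ℝ) / 2) * nT *
            (nE + ni + nj + nk) * (nE + ni + nk + nik) + ((1 : ℝ) / 4) * nik * (nik + nT) * (Z + nE + ni + nj + nk)
            + ((1 : ℝ) / 2) * nik * Z * (nE + ni + nk + nik) + ((1 : ℝ) / 4) * nik * (nij + nik + njk + nT) *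
            (nik + nT) + ((1 : ℝ) / 2) * nik * (nij + nik + njk + nT) * (nj + nij + njk + nT))]
  · -- pair_P12_R0
    linarith only [congrArg (fun z : ℝ => ((1 : ℝ) * nE * nT + ((1 : ℝ) / 2) * nE * njk + (1 : ℝ) * nT * Z +
            (-1 : ℝ) * nT * nT + ((1 : ℝ) / 2) * nij * Z + (-1 : ℝ) * nij * nT + ((-1 : ℝ) / 2) * nij * njk +
            ((1 : ℝ) / 2) * nik * Z + (-1 : ℝ) * nik * nT + ((-1 : ℝ) / 2) * nik * njk + (1 : ℝ) * nj * nT +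
            ((1 : ℝ) / 2) * nj * njk + (1 : ℝ) * njk * Z + ((-1 : ℝ) / 4) * njk * nT + ((1 : ℝ) / 4) * njk * njk +
            (1 : ℝ) * nk * nT + ((1 : ℝ) / 2) * nk * njk) * z) h_sum,
            (by positivity : (0:ℝ) ≤ ((1 : ℝ) / 2) * Z * (nij + nik + nT) * (nij + nik) + ((1 : ℝ) / 2) * Z *
            (nij + nik) * (Z + nE + ni + nj + nk) + (1 : ℝ) * nT * (nE + ni + nj + nk) * (nE + nj + nk + njk) +
            ((1 : ℝ) / 4) * njk * (njk + nT) * (Z + nE + ni + nj + nk) + ((1 : ℝ) / 2) * njk * (nE + nj + nk + njk)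
            * (Z + nE + ni + nj + nk) + ((1 : ℝ) / 4) * njk * (nij + nik + njk + nT) * (njk + nT) + ((1 : ℝ) / 2) *
            njk * (nij + nik + njk + nT) * (ni + nij + nik + nT))]

/-- **Regime B1** (top only: `r = (0, 0, 0, Z²u)`), valid when `Z·N₂ ≤ d·n_⊤` and `u(Z + n_x) ≤ (Z+d)·B_x` for the
        three atoms. [this work] Part 3: the core pair inequalities `↑x` vs `↑x` and `↑x` vs `↑y`, explicit
        retained masses. -/
theorem cert_B1_pairsR (nE ni nj nk nij nik njk nT Z : ℝ)
    (h_nn_E : 0 ≤ nE) (h_nn_0 : 0 ≤ ni) (h_nn_1 : 0 ≤ nj) (h_nn_2 : 0 ≤ nk) (h_nn_01 : 0 ≤ nij) (h_nn_02 : 0 ≤ nik)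
    (h_nn_12 : 0 ≤ njk) (h_nn_T : 0 ≤ nT) (h_nn_Z : 0 ≤ Z) (h_sum : Z = nE + ni + nj + nk + nij + nik + njk + nT) :
    Z * ((ni + nij + nik + nT) * (nij + nik + nT) + (ni + nij + nik + nT) * (nij + nik + nT)) -
            (nij + nik + njk + nT) * (ni + nij + nik + nT) * (ni + nij + nik + nT) ≤ (0 : ℝ) + (0 : ℝ) +
            (Z*Z*(nij + nik + njk + nT)) ∧
    Z * ((nj + nij + njk + nT) * (nij + njk + nT) +
            (nj + nij + njk + nT) * (nij + njk + nT)) - (nij + nik + njk + nT) * (nj + nij + njk + nT) *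
            (nj + nij + njk + nT) ≤ (0 : ℝ) + (0 : ℝ) + (Z*Z*(nij + nik + njk + nT)) ∧
    Z *
            ((nk + nik + njk + nT) * (nik + njk + nT) + (nk + nik + njk + nT) * (nik + njk + nT)) -
            (nij + nik + njk + nT) * (nk + nik + njk + nT) * (nk + nik + njk + nT) ≤ (0 : ℝ) + (0 : ℝ) +
            (Z*Z*(nij + nik + njk + nT)) ∧
    Z * ((ni + nij + nik + nT) * (nij + njk + nT) +
            (nj + nij + njk + nT) * (nij + nik + nT)) - (nij + nik + njk + nT) * (ni + nij + nik + nT) *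
            (nj + nij + njk + nT) ≤ (0 : ℝ) + (Z*Z*(nij + nik + njk + nT)) ∧
    Z *
            ((ni + nij + nik + nT) * (nik + njk + nT) + (nk + nik + njk + nT) * (nij + nik + nT)) -
            (nij + nik + njk + nT) * (ni + nij + nik + nT) * (nk + nik + njk + nT) ≤ (0 : ℝ) +
            (Z*Z*(nij + nik + njk + nT)) ∧
    Z * ((nj + nij + njk + nT) * (nik + njk + nT) +
            (nk + nik + njk + nT) * (nij + njk + nT)) - (nij + nik + njk + nT) * (nj + nij + njk + nT) *
            (nk + nik + njk + nT) ≤ (0 : ℝ) + (Z*Z*(nij + nik + njk + nT)) := by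
  refine ⟨?_, ?_, ?_, ?_, ?_, ?_⟩
  · -- pair_R0_R0
    linarith only [congrArg (fun z : ℝ => ((1 : ℝ) * nE * nT + (1 : ℝ) * nE * nij + (1 : ℝ) * nE * nik +
            ((1 : ℝ) / 3) * nE * njk + (1 : ℝ) * nT * Z + (-1 : ℝ) * nT * nT + (-1 : ℝ) * ni * nT + (-1 : ℝ) * ni *
            nij + (-1 : ℝ) * ni * nik + ((-1 : ℝ) / 3) * ni * njk + (1 : ℝ) * nij * Z + (-2 : ℝ) * nij * nT +
            (-1 : ℝ) * nij * nij + (-2 : ℝ) * nij * nik + (1 : ℝ) * nik * Z + (-2 : ℝ) * nik * nT + (-1 : ℝ) * nik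
            * nik + (1 : ℝ) * nj * nT + (1 : ℝ) * nj * nij + (1 : ℝ) * nj * nik + ((1 : ℝ) / 3) * nj * njk +
            ((1 : ℝ) / 3) * njk * Z + ((1 : ℝ) / 3) * njk * njk + (1 : ℝ) * nk * nT + (1 : ℝ) * nk * nij + (1 : ℝ)
            * nk * nik + ((1 : ℝ) / 3) * nk * njk) * z) h_sum,
            (by positivity : (0:ℝ) ≤ ((2 : ℝ) / 3) * (nij + nik + nT) * (nE + nj + nk) * (nE + nj + nk + njk) +
            ((2 : ℝ) / 3) * njk * Z * (nij + nik + nT) + ((2 : ℝ) / 3) * njk * Z * Z + ((2 : ℝ) / 3) * njk *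
            (ni + nij + nik + nT) * (Z + ni) + ((1 : ℝ) / 3) * (nij + nik + njk + nT) * (nE + nj + nk + njk) *
            (nE + nj + nk + njk))]
  · -- pair_R1_R1
    linarith only [congrArg (fun z : ℝ => ((1 : ℝ) * nE * nT + (1 : ℝ) * nE * nij + ((1 : ℝ) / 3) * nE * nik +
            (1 : ℝ) * nE * njk + (1 : ℝ) * nT * Z + (-1 : ℝ) * nT * nT + (1 : ℝ) * ni * nT + (1 : ℝ) * ni * nij +
            ((1 : ℝ) / 3) * ni * nik + (1 : ℝ) * ni * njk + (1 : ℝ) * nij * Z + (-2 : ℝ) * nij * nT + (-1 : ℝ) *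
            nij * nij + (-2 : ℝ) * nij * njk + ((1 : ℝ) / 3) * nik * Z + ((1 : ℝ) / 3) * nik * nik + (-1 : ℝ) * nj
            * nT + (-1 : ℝ) * nj * nij + ((-1 : ℝ) / 3) * nj * nik + (-1 : ℝ) * nj * njk + (1 : ℝ) * njk * Z +
            (-2 : ℝ) * njk * nT + (-1 : ℝ) * njk * njk + (1 : ℝ) * nk * nT + (1 : ℝ) * nk * nij + ((1 : ℝ) / 3) *
            nk * nik + (1 : ℝ) * nk * njk) * z) h_sum, (by positivity : (0:ℝ) ≤ ((2 : ℝ) / 3) * (nij + njk + nT) *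
            (nE + ni + nk) * (nE + ni + nk + nik) + ((2 : ℝ) / 3) * nik * Z * (nij + njk + nT) + ((2 : ℝ) / 3) *
            nik * Z * Z + ((2 : ℝ) / 3) * nik * (nj + nij + njk + nT) * (Z + nj) + ((1 : ℝ) / 3) *
            (nij + nik + njk + nT) * (nE + ni + nk + nik) * (nE + ni + nk + nik))]
  · -- pair_R2_R2
    linarith only [congrArg (fun z : ℝ => ((1 : ℝ) * nE * nT + ((1 : ℝ) / 3) * nE * nij + (1 : ℝ) * nE * nik +
            (1 : ℝ) * nE * njk + (1 : ℝ) * nT * Z + (-1 : ℝ) * nT * nT + (1 : ℝ) * ni * nT + ((1 : ℝ) / 3) * ni *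
            nij + (1 : ℝ) * ni * nik + (1 : ℝ) * ni * njk + ((1 : ℝ) / 3) * nij * Z + ((1 : ℝ) / 3) * nij * nij +
            (1 : ℝ) * nik * Z + (-2 : ℝ) * nik * nT + (-1 : ℝ) * nik * nik + (-2 : ℝ) * nik * njk + (1 : ℝ) * nj *
            nT + ((1 : ℝ) / 3) * nj * nij + (1 : ℝ) * nj * nik + (1 : ℝ) * nj * njk + (1 : ℝ) * njk * Z + (-2 : ℝ)
            * njk * nT + (-1 : ℝ) * njk * njk + (-1 : ℝ) * nk * nT + ((-1 : ℝ) / 3) * nk * nij + (-1 : ℝ) * nk *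
            nik + (-1 : ℝ) * nk * njk) * z) h_sum, (by positivity : (0:ℝ) ≤ ((2 : ℝ) / 3) * (nik + njk + nT) *
            (nE + ni + nj) * (nE + ni + nj + nij) + ((2 : ℝ) / 3) * nij * Z * (nik + njk + nT) + ((2 : ℝ) / 3) *
            nij * Z * Z + ((2 : ℝ) / 3) * nij * (nk + nik + njk + nT) * (Z + nk) + ((1 : ℝ) / 3) *
            (nij + nik + njk + nT) * (nE + ni + nj + nij) * (nE + ni + nj + nij))]
  · -- pair_R0_R1
    linarith only [congrArg (fun z : ℝ => ((1 : ℝ) * nE * nT + (1 : ℝ) * nE * nij + (1 : ℝ) * nT * Z + (-1 : ℝ) *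
            nT * nT + (1 : ℝ) * nij * Z + (-2 : ℝ) * nij * nT + (-1 : ℝ) * nij * nij + (1 : ℝ) * nik * Z + (1 : ℝ)
            * njk * Z + (1 : ℝ) * nk * nT + (1 : ℝ) * nk * nij) * z) h_sum,
            (by positivity : (0:ℝ) ≤ (1 : ℝ) * (nij + nT) * (nE + nj + nk + njk) * (nE + ni + nk + nik) + (1 : ℝ) *
            (ni + nij + nik + nT) * (nj + nij + njk + nT) * (nik + njk) + (1 : ℝ) * nik * Z * (nE + ni + nk + nik)
            + (1 : ℝ) * njk * Z * (nE + nj + nk + njk))]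
  · -- pair_R0_R2
    linarith only [congrArg (fun z : ℝ => ((1 : ℝ) * nE * nT + (1 : ℝ) * nE * nik + (1 : ℝ) * nT * Z + (-1 : ℝ) *
            nT * nT + (1 : ℝ) * nij * Z + (1 : ℝ) * nik * Z + (-2 : ℝ) * nik * nT + (-1 : ℝ) * nik * nik + (1 : ℝ)
            * nj * nT + (1 : ℝ) * nj * nik + (1 : ℝ) * njk * Z) * z) h_sum,
            (by positivity : (0:ℝ) ≤ (1 : ℝ) * (nik + nT) * (nE + nj + nk + njk) * (nE + ni + nj + nij) + (1 : ℝ) *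
            (ni + nij + nik + nT) * (nk + nik + njk + nT) * (nij + njk) + (1 : ℝ) * nij * Z * (nE + ni + nj + nij)
            + (1 : ℝ) * njk * Z * (nE + nj + nk + njk))]
  · -- pair_R1_R2
    linarith only [congrArg (fun z : ℝ => ((1 : ℝ) * nE * nT + (1 : ℝ) * nE * njk + (1 : ℝ) * nT * Z + (-1 : ℝ) *
            nT * nT + (1 : ℝ) * ni * nT + (1 : ℝ) * ni * njk + (1 : ℝ) * nij * Z + (1 : ℝ) * nik * Z + (1 : ℝ) *
            njk * Z + (-2 : ℝ) * njk * nT + (-1 : ℝ) * njk * njk) * z) h_sum,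
            (by positivity : (0:ℝ) ≤ (1 : ℝ) * (njk + nT) * (nE + ni + nk + nik) * (nE + ni + nj + nij) + (1 : ℝ) *
            (nj + nij + njk + nT) * (nk + nik + njk + nT) * (nij + nik) + (1 : ℝ) * nij * Z * (nE + ni + nj + nij)
            + (1 : ℝ) * nik * Z * (nE + ni + nk + nik))]

end Summit.CriticalPhenomena.PercolationContinuityZ3.Theorems.SahiE3MajCert
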